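import Literature.AnabelianGeometry.SemiGraphs.PSCCoveringDatum
import Literature.AnabelianGeometry.SemiGraphs.PSCGraphicity
import HarnessLib

/-!
# Branch data of a PSC datum and the covering datum `G_U` that unfolds loops ([CombGC] Def. 1.1 (ii))

Mochizuki, *A combinatorial version of the Grothendieck conjecture*, Tohoku Math. J. **59** (2007),
Def. 1.1 (i)–(ii), author's ms p. 6: the underlying semi-graph of a pointed stable curve has as closed
edges the nodes, each with TWO branches ([SemiAnbd] §1 p. 11), and "a finite étale covering of `G`
that arises from an open subgroup of `Π_G`" is a `Π_G`-covering `G' → G`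
[cite: MochizukiCombGC2007, Def 1.1(ii) p.6].

REPAIR of the covering datum `PSCDatum.restrict` (`PSCCoveringDatum.lean`) after the kernel-certified
finding F-L5t6g4-1 of the abc-iut cell (second reader abc-iut-L5-t6): the interface
`PSCDatum.nodeGp_le` records the two branch inclusions `γ_i Π_e γ_i⁻¹ ⊆ Π_{v_i}` of a node only
EXISTENTIALLY, and `restrict` attaches the covering nodes through conjugators CHOSEN from those
existentials (`nodeConjFst/Snd`).  For a LOOP (`nodeEnds e = s(v, v)`) the two existentials are
the same proposition, the two choices coincide (`nodeConjFst_eq_nodeConjSnd_of_isDiag`), and every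
node of `restrictGraph` over a loop is again a loop (`restrictGraph_nodeEnds_isDiag_of_loop`) —
whereas genuine `Π_G`-coverings unfold loops (the degree-`l` `Π^unr`-covering of an irreducible nodal
curve is an `l`-cycle).  This file supplies the missing DATUM and the corrected construction:

* `PSCDatum.BranchData G`: for every node `e` an ORDERED pair of end vertices `(fst e, snd e)` with
  `nodeEnds e = s(fst e, snd e)` and an ordered pair of branch conjugators
  `conjFst e • Π_e ≤ Π_{fst e}`, `conjSnd e • Π_e ≤ Π_{snd e}` (for a loop: the two `Π_v`-classes of
  branch embeddings, which only the geometric origin knows); `G.chosenBranchData` = the choice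
  `restrict` makes;
* `PSCDatum.restrictBD G bd U hU : PSCDatum ↥U`: the covering datum built with the branch data
  `bd` — SAME vertices / nodes / cusps / representative subgroups / `Σ` / cusp abutments / local
  degrees as `restrict` (so every count-, subgroup- and filtration-level result about `restrict`
  holds verbatim for `restrictBD bd`: `restrictBD_vertGp`, …, and the `Iff.rfl` bridges in the
  proof companions), but the node `U x Π_e` now joins `U x γ₁⁻¹ Π_{v₁}` and `U x γ₂⁻¹ Π_{v₂}` for
  THE GIVEN `(γ₁, γ₂) = (bd.conjFst e, bd.conjSnd e)`; `restrictBD_chosen : restrictBD chosen = restrict`;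
* the corrected origin-level statement `RestrictBDOfPSCTypeHolds Ω`: a `G` of PSC-type carries
  branch data (its geometric one) for which every `G_U` is of PSC-type.  The earlier
  `RestrictOfPSCTypeHolds` (`PSCCoveringDatumTransport.lean`) quantifies over the loop-degenerate
  `restrict` and is NOT satisfiable at the geometric origin for graphs with loops — do not bind it.

Definitions + defining equations + the two warning lemmas; no statement takes a side on
[IUTchIII] Cor. 3.12.
-/

namespace Literature.AnabelianGeometry.SemiGraphs

open scoped Pointwise

universe u

namespace PSCDatum

open PSCCovering

variable {P : Type u} [Group P] [TopologicalSpace P] (G : PSCDatum P)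

/-! ### Branch data -/

/-- **Branch data** of a PSC datum: for every node `e` an ordered pair of end vertices and an
ordered pair of conjugators exhibiting the two branch inclusions `Π_e ↪ Π_{v₁}`, `Π_e ↪ Π_{v₂}`
([CombGC] Def. 1.1 (i)–(ii): the two branches of the closed edge `e`; for a loop `v₁ = v₂` these
are the two — in general NOT `Π_v`-conjugate — branch embeddings).  The interface field
`PSCDatum.nodeGp_le` asserts exactly that such data exist. [cite: MochizukiCombGC2007, Def 1.1(ii) p.6] -/
structure BranchData (G : PSCDatum P) where
  /-- first end vertex of the node `e` -/
  fst : G.graph.N → G.graph.V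
  /-- second end vertex of the node `e` -/
  snd : G.graph.N → G.graph.V
  /-- conjugator of the first branch: `conjFst e • Π_e ≤ Π_{fst e}` -/
  conjFst : G.graph.N → ConjAct P
  /-- conjugator of the second branch: `conjSnd e • Π_e ≤ Π_{snd e}` -/
  conjSnd : G.graph.N → ConjAct P
  nodeEnds_eq : ∀ e, G.graph.nodeEnds e = s(fst e, snd e)
  conjFst_smul_le : ∀ e, conjFst e • G.nodeGp e ≤ G.vertGp (fst e)
  conjSnd_smul_le : ∀ e, conjSnd e • G.nodeGp e ≤ G.vertGp (snd e)

/-- The branch data CHOSEN from the existential field `nodeGp_le` (`nodeFst/nodeSnd`,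
`nodeConjFst/nodeConjSnd` of `PSCCoveringDatum.lean`); degenerate on loops
(`nodeConjFst_eq_nodeConjSnd_of_isDiag`). [cite: MochizukiCombGC2007, Def 1.1(ii) p.6] -/
noncomputable def chosenBranchData : G.BranchData where
  fst := G.nodeFst
  snd := G.nodeSnd
  conjFst := G.nodeConjFst
  conjSnd := G.nodeConjSnd
  nodeEnds_eq := G.nodeEnds_eq
  conjFst_smul_le := G.nodeConjFst_smul_le
  conjSnd_smul_le := G.nodeConjSnd_smul_le

/-- Branch data always exist (the chosen ones). [cite: MochizukiCombGC2007, Def 1.1(ii) p.6] -/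
theorem nonempty_branchData : Nonempty G.BranchData := ⟨G.chosenBranchData⟩

/-! ### Warning lemmas: the chosen branch data do not separate the two branches of a loop -/

/-- For a loop `e` (`nodeEnds e` diagonal) the two CHOSEN branch conjugators coincide: the two
existential clauses of `nodeGp_le` are then the same proposition (finding F-L5t6g4-1, second reader
abc-iut-L5-t6). [cite: MochizukiCombGC2007, Def 1.1(ii) p.6] -/
theorem nodeConjFst_eq_nodeConjSnd_of_isDiag (e : G.graph.N) (h : (G.graph.nodeEnds e).IsDiag) :
    G.nodeConjFst e = G.nodeConjSnd e := by
  have hv : G.nodeFst e = G.nodeSnd e := by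
    rw [G.nodeEnds_eq e, Sym2.mk_isDiag_iff] at h
    exact h
  have key : ∀ (v₁ v₂ : G.graph.V) (hv : v₁ = v₂)
      (p₁ : ∃ γ : ConjAct P, γ • G.nodeGp e ≤ G.vertGp v₁)
      (p₂ : ∃ γ : ConjAct P, γ • G.nodeGp e ≤ G.vertGp v₂),
      Classical.choose p₁ = Classical.choose p₂ := by
    intro v₁ v₂ hv p₁ p₂
    subst hv
    rfl
  exact key _ _ hv _ _

variable (U : Subgroup P) [U.FiniteIndex]

/-- Consequently every node of `G.restrictGraph U` lying over a loop of `G` is a loop: `restrict`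
does NOT unfold loops (genuine `Π_G`-coverings do). [cite: MochizukiCombGC2007, Def 1.1(ii) p.6] -/
theorem restrictGraph_nodeEnds_isDiag_of_loop (d : (G.restrictGraph U).N)
    (h : (G.graph.nodeEnds d.1).IsDiag) : ((G.restrictGraph U).nodeEnds d).IsDiag := by
  have hv : G.nodeFst d.1 = G.nodeSnd d.1 := by
    have h' := h
    rw [G.nodeEnds_eq d.1, Sym2.mk_isDiag_iff] at h'
    exact h'
  have hγ := G.nodeConjFst_eq_nodeConjSnd_of_isDiag d.1 h
  rw [restrictGraph_nodeEnds]
  refine Sym2.mk_isDiag_iff.mpr ?_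
  have key : ∀ (v₁ v₂ : G.graph.V) (hv : v₁ = v₂) (γ₁ γ₂ : ConjAct P) (hγ : γ₁ = γ₂),
      G.vertexOver U v₁ (G.nrep U d * (ConjAct.ofConjAct γ₁)⁻¹) =
        G.vertexOver U v₂ (G.nrep U d * (ConjAct.ofConjAct γ₂)⁻¹) := by
    intro v₁ v₂ hv γ₁ γ₂ hγ
    subst hv; subst hγ; rfl
  exact key _ _ hv _ _ hγ

/-! ### The covering datum built from branch data -/

/-- The underlying semi-graph of `G_U` built from the branch data `bd`: as `restrictGraph`, except
that the node `U x Π_e` joins `U x γ₁⁻¹ Π_{v₁}` and `U x γ₂⁻¹ Π_{v₂}` for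
`(γ₁, γ₂) = (bd.conjFst e, bd.conjSnd e)`. [cite: MochizukiCombGC2007, Def 1.1(ii) p.6] -/
noncomputable def restrictGraphBD (bd : G.BranchData) : PSCSemiGraph where
  V := Σ v : G.graph.V, dcFin U (G.vertGp v)
  N := Σ e : G.graph.N, dcFin U (G.nodeGp e)
  C := Σ c : G.graph.C, dcFin U (G.cuspGp c)
  nodeEnds d :=
    s(G.vertexOver U (bd.fst d.1) (G.nrep U d * (ConjAct.ofConjAct (bd.conjFst d.1))⁻¹),
      G.vertexOver U (bd.snd d.1) (G.nrep U d * (ConjAct.ofConjAct (bd.conjSnd d.1))⁻¹))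
  cuspEnd d :=
    G.vertexOver U (G.graph.cuspEnd d.1) (G.crep U d * (ConjAct.ofConjAct (G.cuspConj d.1))⁻¹)

/-- With the chosen branch data this is `restrictGraph`. [cite: MochizukiCombGC2007, Def 1.1(ii) p.6] -/
theorem restrictGraphBD_chosen : G.restrictGraphBD U G.chosenBranchData = G.restrictGraph U := rfl

/-- The Riemann–Hurwitz genus of the vertex `w` of `G_U`, with the branch count of the graph built
from `bd`. [cite: MochizukiCombGC2007, Rmk 1.1.5 p.8] -/
noncomputable def restrictGenusBD (bd : G.BranchData) (w : (G.restrictGraphBD U bd).V) : ℕ :=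
  hurwitzGenus (G.localDegree U w) (G.genus w.1) (G.graph.branchCount w.1)
    ((G.restrictGraphBD U bd).branchCount w)

variable [IsTopologicalGroup P] (hU : IsOpen (U : Set P))

/-- **[CombGC] Def. 1.1 (ii): the finite étale `Π_G`-covering `G_U → G` built from branch data**
(the repaired `restrict`): same vertices, nodes, cusps, representative subgroups `U ∩ y Π_v y⁻¹`
etc., `Σ`, cusp abutments and local degrees as `restrict`; node abutments from `bd`; Riemann–Hurwitz
genera from the resulting branch counts. [cite: MochizukiCombGC2007, Def 1.1(ii) p.6] -/
noncomputable def restrictBD (bd : G.BranchData) : PSCDatum U where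
  Sigma := G.Sigma
  sigma_prime := G.sigma_prime
  sigma_nonempty := G.sigma_nonempty
  graph := G.restrictGraphBD U bd
  vertGp := G.restrictVertGp U
  nodeGp := G.restrictNodeGp U
  cuspGp := G.restrictCuspGp U
  genus := G.restrictGenusBD U bd
  isClosed_vertGp := (G.restrict U hU).isClosed_vertGp
  isClosed_nodeGp := (G.restrict U hU).isClosed_nodeGp
  isClosed_cuspGp := (G.restrict U hU).isClosed_cuspGp
  nodeGp_le d := ⟨_, _, rfl, exists_conj_subgroupOf_le (bd.conjFst_smul_le d.1) _,
    exists_conj_subgroupOf_le (bd.conjSnd_smul_le d.1) _⟩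
  cuspGp_le := (G.restrict U hU).cuspGp_le
  proSigma := (G.restrict U hU).proSigma

/-- `restrict` is `restrictBD` with the chosen (loop-degenerate) branch data.
[cite: MochizukiCombGC2007, Def 1.1(ii) p.6] -/
theorem restrictBD_chosen : G.restrictBD U hU G.chosenBranchData = G.restrict U hU := rfl

/-! ### Defining equations (all but `nodeEnds`/`genus` literally those of `restrict`) -/

variable (bd : G.BranchData)

/-- Same `Σ`. [cite: MochizukiCombGC2007, Def 1.1(ii) p.6] -/
@[simp] theorem restrictBD_Sigma : (G.restrictBD U hU bd).Sigma = G.Sigma := rfl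

/-- The underlying graph. [cite: MochizukiCombGC2007, Def 1.1(ii) p.6] -/
@[simp] theorem restrictBD_graph : (G.restrictBD U hU bd).graph = G.restrictGraphBD U bd := rfl

/-- `Π_w = U ∩ y_w Π_v y_w⁻¹`, as for `restrict`. [cite: MochizukiCombGC2007, Def 1.1(ii) p.6] -/
theorem restrictBD_vertGp (w : (G.restrictGraphBD U bd).V) :
    (G.restrictBD U hU bd).vertGp w = (G.restrict U hU).vertGp w := rfl

/-- Nodal subgroups as for `restrict`. [cite: MochizukiCombGC2007, Def 1.1(ii) p.7] -/
theorem restrictBD_nodeGp (d : (G.restrictGraphBD U bd).N) :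
    (G.restrictBD U hU bd).nodeGp d = (G.restrict U hU).nodeGp d := rfl

/-- Cuspidal subgroups as for `restrict`. [cite: MochizukiCombGC2007, Def 1.1(ii) p.7] -/
theorem restrictBD_cuspGp (d : (G.restrictGraphBD U bd).C) :
    (G.restrictBD U hU bd).cuspGp d = (G.restrict U hU).cuspGp d := rfl

omit [IsTopologicalGroup P] in
/-- Cusp abutments as for `restrict`. [cite: MochizukiCombGC2007, Def 1.1(ii) p.6] -/
theorem restrictGraphBD_cuspEnd (d : (G.restrictGraphBD U bd).C) :
    (G.restrictGraphBD U bd).cuspEnd d = (G.restrictGraph U).cuspEnd d := rfl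

omit [IsTopologicalGroup P] in
/-- Node abutments from the branch data. [cite: MochizukiCombGC2007, Def 1.1(ii) p.6] -/
theorem restrictGraphBD_nodeEnds (d : (G.restrictGraphBD U bd).N) :
    (G.restrictGraphBD U bd).nodeEnds d =
      s(G.vertexOver U (bd.fst d.1) (G.nrep U d * (ConjAct.ofConjAct (bd.conjFst d.1))⁻¹),
        G.vertexOver U (bd.snd d.1) (G.nrep U d * (ConjAct.ofConjAct (bd.conjSnd d.1))⁻¹)) := rfl

/-- The genus field. [cite: MochizukiCombGC2007, Rmk 1.1.5 p.8] -/
theorem restrictBD_genus (w : (G.restrictGraphBD U bd).V) :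
    (G.restrictBD U hU bd).genus w = hurwitzGenus (G.localDegree U w) (G.genus w.1)
      (G.graph.branchCount w.1) ((G.restrictGraphBD U bd).branchCount w) := rfl

/-- `G_U` (any branch data) is sturdy iff all its Riemann–Hurwitz genera are `≥ 2`.
[cite: MochizukiCombGC2007, Rmk 1.1.5 p.8] -/
theorem isSturdy_restrictBD_iff :
    (G.restrictBD U hU bd).IsSturdy ↔ ∀ w, 2 ≤ G.restrictGenusBD U bd w := Iff.rfl

/-! ### Class (i) notions do not see the branch data -/

/-- Verticial subgroups of `G_U` do not depend on the branch data. [cite: MochizukiCombGC2007, Def 1.1(ii) p.6] -/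
theorem isVerticial_restrictBD_iff (A : Subgroup U) :
    (G.restrictBD U hU bd).IsVerticial A ↔ (G.restrict U hU).IsVerticial A := Iff.rfl

/-- Nodal subgroups of `G_U` do not depend on the branch data. [cite: MochizukiCombGC2007, Def 1.1(ii) p.7] -/
theorem isNodal_restrictBD_iff (A : Subgroup U) :
    (G.restrictBD U hU bd).IsNodal A ↔ (G.restrict U hU).IsNodal A := Iff.rfl

/-- Cuspidal subgroups of `G_U` do not depend on the branch data. [cite: MochizukiCombGC2007, Def 1.1(ii) p.7] -/
theorem isCuspidal_restrictBD_iff (A : Subgroup U) :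
    (G.restrictBD U hU bd).IsCuspidal A ↔ (G.restrict U hU).IsCuspidal A := Iff.rfl

/-- Edge-like subgroups of `G_U` do not depend on the branch data. [cite: MochizukiCombGC2007, Def 1.1(ii) p.7] -/
theorem isEdgeLike_restrictBD_iff (A : Subgroup U) :
    (G.restrictBD U hU bd).IsEdgeLike A ↔ (G.restrict U hU).IsEdgeLike A := Iff.rfl

/-- Cusp counts of coverings of `G_U` do not depend on the branch data. [cite: MochizukiCombGC2007, Def 1.1(ii) p.6] -/
theorem restrictBD_cuspCount (V : Subgroup U) :
    (G.restrictBD U hU bd).cuspCount V = (G.restrict U hU).cuspCount V := rfl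

/-- Node counts likewise. [cite: MochizukiCombGC2007, Def 1.1(ii) p.6] -/
theorem restrictBD_nodeCount (V : Subgroup U) :
    (G.restrictBD U hU bd).nodeCount V = (G.restrict U hU).nodeCount V := rfl

/-- Vertex counts likewise. [cite: MochizukiCombGC2007, Def 1.1(ii) p.6] -/
theorem restrictBD_vertCount (V : Subgroup U) :
    (G.restrictBD U hU bd).vertCount V = (G.restrict U hU).vertCount V := rfl

/-- The filtration step `M^vert` likewise. [cite: MochizukiCombGC2007, Def 1.1(ii) p.7] -/
theorem restrictBD_vertFil (V : Subgroup U) :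
    (G.restrictBD U hU bd).vertFil V = (G.restrict U hU).vertFil V := rfl

/-- `M^edge` likewise. [cite: MochizukiCombGC2007, Def 1.1(ii) p.7] -/
theorem restrictBD_edgeFil (V : Subgroup U) :
    (G.restrictBD U hU bd).edgeFil V = (G.restrict U hU).edgeFil V := rfl

/-- `M^cusp` likewise. [cite: MochizukiCombGC2007, Def 1.1(ii) p.7] -/
theorem restrictBD_cuspFil (V : Subgroup U) :
    (G.restrictBD U hU bd).cuspFil V = (G.restrict U hU).cuspFil V := rfl

/-- `cptKer`, `unrKer`, `grphKer` of `G_U` likewise. [cite: MochizukiCombGC2007, Def 1.1(ii) p.7] -/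
theorem restrictBD_unrKer : (G.restrictBD U hU bd).unrKer = (G.restrict U hU).unrKer := rfl

/-! ### Origin-level statement: coverings of PSC-type data are of PSC-type (repaired) -/

/-- **[CombGC] Def. 1.1 (ii)** (p. 6), over the origin predicate, REPAIRED form: a semi-graph of
anabelioids of PSC-type carries branch data (the geometric one: the two branches of every node)
such that for every open subgroup `U ⊆ Π_G` of finite index the `Π_G`-covering datum `G_U` built
from them is again of PSC-type ("a finite étale covering of `G` that arises from an open subgroup
of `Π_G`").  Supersedes `RestrictOfPSCTypeHolds`, which is stated for the loop-degenerate `restrict`.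
[cite: MochizukiCombGC2007, Def 1.1(ii) p.6] -/
def RestrictBDOfPSCTypeHolds (Ω : PSCOrigin.{u}) : Prop :=
  ∀ ⦃Q : Type u⦄ [Group Q] [TopologicalSpace Q] [IsTopologicalGroup Q] (G : PSCDatum Q),
    Ω.IsOfPSCType G → ∃ bd : G.BranchData, ∀ (U : Subgroup Q) [U.FiniteIndex]
      (hU : IsOpen (U : Set Q)), Ω.IsOfPSCType (G.restrictBD U hU bd)

end PSCDatum

end Literature.AnabelianGeometry.SemiGraphs
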